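import Summits.HubbardSuperconductivity.HubbardSuperconductivity.Theorems.AnisotropyChordTransferFibre3RowDOffD
import Summits.HubbardSuperconductivity.HubbardSuperconductivity.Theorems.AnisotropyChordTransferFibre3RowDMFormTransform
import Summits.HubbardSuperconductivity.HubbardSuperconductivity.Theorems.AnisotropyChordTransferFibre3TwoMagnon
import Summits.HubbardSuperconductivity.HubbardSuperconductivity.Theorems.AnisotropyChordTransferFibre3IMS
import Summits.HubbardSuperconductivity.HubbardSuperconductivity.Theorems.AnisotropyChordTransferFibre3RowDLowGRow

/-!
# Route `AnisotropyChord` / H0 rotor rung: PartN41-D §2 — `RhatOneLoop` PROVED (the one-loop form of the residual coefficients)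

Theory-1 g22's PartN41-D §2 `RhatOneLoop` (port …Fibre3KT2aRow; oneloop_kt2a): `R̂′(k) = den(T⁺;k)·Ψ̂¹(k) − Δ·FTW(k) + Bd(k)`.
`R′ = 1_{Dᶜ}G`, `G = H₀Ψ¹ − ΔWΨ¹ − (ε₁ + T⁺)Ψ¹`; `OffDTransform` removes the three `D`-lines, on which `G = H₀Ψ¹` (`Ψ¹ = 0` on `D`);
`FT[H₀Ψ¹] = efree·Ψ̂¹` (plane waves diagonalise `H₀`, `ip_pw_H0apply`); `FT[WΨ¹]` and the line sums of `H₀Ψ¹` are the nearest-neighbour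
slices, i.e. pair transforms `Y_e` (★ `RowD.ftW_eq`, ★ `RowD.lines_H0_eq`).  ★ `rhatOneLoop_holds : RhatOneLoop L Δ`; with …RowDLowGRow,
★ `lowGRowForm_holds : LowGRowForm L Δ` (THE ROW FORM of `lowG`).
Prover seat `hubbard-h0-rotor-p1` g27 (route lead); helper for stmt-HubbardSuperconductivity-23918 (`--supports`, helper class).
WHAT THIS IS NOT: nothing here proves superconductivity in the Hubbard model.  Tree imports only; no new definitions; no sorry.
-/

set_option linter.dupNamespace false
set_option autoImplicit false

noncomputable section

open scoped BigOperators

namespace Summit.HubbardSuperconductivity.HubbardSuperconductivity.Theorems.AnisotropyChord.Transfer.Fibre3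

variable (L : ℕ) [NeZero L]

namespace RowD

/-- plane waves diagonalise `H₀`: `FT[H₀F](k) = efree(k)·F̂(k)`. [folklore] -/
theorem cfgDFT_H0apply (F : Cfg L → ℂ) (k₂ k₃ : Tor L) :
    cfgDFT L (H0apply L (K1 L) F) k₂ k₃ = (efree L (k₂, k₃) : ℂ) * cfgDFT L F k₂ k₃ :=
  ip_pw_H0apply L (k₂, k₃) F

/-- `Σ_a 1_NN(a) h(a) = h(x̂) + h(−x̂) + h(ŷ) + h(−ŷ)` (complex values, `L ≥ 3`). [folklore] -/
theorem sum_ite_isNN_complex (hL : 3 ≤ L) (h : Tor L → ℂ) :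
    ∑ a : Tor L, (if IsNN L a then h a else 0) = h (ex L) + h (-ex L) + h (ey L) + h (-ey L) := by
  classical
  obtain ⟨d1, d2, d3, d4, d5, d6⟩ := nn_distinct L hL
  rw [← Finset.sum_filter, filter_isNN, Finset.sum_insert (by simp [d1, d2, d3]), Finset.sum_insert (by simp [d4, d5]),
    Finset.sum_insert (by simp [d6]), Finset.sum_singleton]
  ring

omit [NeZero L] in
/-- `Ψ¹ = trialK1` written out. [folklore] -/
theorem trialK1_apply (f : Tor L → ℝ) (a b : Tor L) :
    trialK1 L f (a, b) = (1 + phase L (K1 L) a + phase L (K1 L) b) * (((f a * f b * f (b - a) : ℝ)) : ℂ) := rfl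

/-- slice `a = e` (a nearest neighbour): `Σ_b e^{−i(k₂e + k₃b)} Ψ¹(e,b) = f_nn e^{−ik₂e}[(1 + e^{iθe})Y_e(k₃) + Y_e(k₃ − K₁)]`. [folklore] -/
theorem slice1 (f : Tor L → ℝ) (e : Tor L) (hfe : f e = f (K1 L)) (k₂ k₃ : Tor L) :
    (∑ b : Tor L, (starRingEnd ℂ) (phase L k₂ e * phase L k₃ b) * trialK1 L f (e, b))
      = (f (K1 L) : ℂ) * ((starRingEnd ℂ) (phase L k₂ e) * ((1 + phase L (K1 L) e) * Yfun L f e k₃ + Yfun L f e (k₃ - K1 L))) := by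
  unfold Yfun dft
  simp only [trialK1_apply, hfe, conj_phase_sub_K1]
  simp only [Finset.mul_sum, ← Finset.sum_add_distrib]
  refine Finset.sum_congr rfl (fun b _ => ?_)
  rw [map_mul]; push_cast; ring

/-- slice `b = e`: `Σ_a e^{−i(k₂a + k₃e)} Ψ¹(a,e) = f_nn e^{−ik₃e}[(1 + e^{iθe})Y_e(k₂) + Y_e(k₂ − K₁)]` (`f` even). [folklore] -/
theorem slice2 (f : Tor L → ℝ) (hev : ∀ r : Tor L, f (-r) = f r) (e : Tor L) (hfe : f e = f (K1 L)) (k₂ k₃ : Tor L) :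
    (∑ a : Tor L, (starRingEnd ℂ) (phase L k₂ a * phase L k₃ e) * trialK1 L f (a, e))
      = (f (K1 L) : ℂ) * ((starRingEnd ℂ) (phase L k₃ e) * ((1 + phase L (K1 L) e) * Yfun L f e k₂ + Yfun L f e (k₂ - K1 L))) := by
  unfold Yfun dft
  have hsym : ∀ a : Tor L, f (e - a) = f (a - e) := fun a => by rw [← neg_sub, hev]
  simp only [trialK1_apply, hfe, hsym, conj_phase_sub_K1]
  simp only [Finset.mul_sum, ← Finset.sum_add_distrib]
  refine Finset.sum_congr rfl (fun a _ => ?_)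
  rw [map_mul]; push_cast; ring

/-- slice `b = a + e`: `Σ_a e^{−i(k₂a + k₃(a+e))} Ψ¹(a,a+e) = f_nn e^{−ik₃e}[Y_{−e}(k₂+k₃) + (1 + e^{iθe})Y_{−e}(k₂+k₃−K₁)]`. [folklore] -/
theorem slice3 (f : Tor L → ℝ) (e : Tor L) (hfe : f e = f (K1 L)) (k₂ k₃ : Tor L) :
    (∑ a : Tor L, (starRingEnd ℂ) (phase L k₂ a * phase L k₃ (a + e)) * trialK1 L f (a, a + e))
      = (f (K1 L) : ℂ) * ((starRingEnd ℂ) (phase L k₃ e) *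
          (Yfun L f (-e) (k₂ + k₃) + (1 + phase L (K1 L) e) * Yfun L f (-e) (k₂ + k₃ - K1 L))) := by
  unfold Yfun dft
  simp only [trialK1_apply, add_sub_cancel_left, hfe, sub_neg_eq_add, conj_phase_sub_K1, phase_add_left, phase_add, map_mul]
  simp only [Finset.mul_sum, ← Finset.sum_add_distrib]
  refine Finset.sum_congr rfl (fun a _ => ?_)
  push_cast; ring

/-- ★ `FT[WΨ¹] = FTW`. [folklore] -/
theorem ftW_eq (hL : 3 ≤ L) {Δ lam2 : ℝ} {f : Tor L → ℝ} (hf : IsTwoMagnon L Δ lam2 f) (hev : ∀ r : Tor L, f (-r) = f r)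
    (k₂ k₃ : Tor L) :
    cfgDFT L (fun c => (Wcount L c : ℂ) * trialK1 L f c) k₂ k₃ = FTWfun L f k₂ k₃ := by
  have hnn := hf.2.1
  have f1 : f (ex L) = f (K1 L) := hnn _ (by unfold nnList ex; simp)
  have f2 : f (-ex L) = f (K1 L) := hnn _ (by rw [← neg_ex]; unfold nnList; simp)
  have f3 : f (ey L) = f (K1 L) := hnn _ (by unfold nnList ey; simp)
  have f4 : f (-ey L) = f (K1 L) := hnn _ (by rw [← neg_ey]; unfold nnList; simp)
  -- split `W` into the three indicators
  have hW : ∀ c : Cfg L, (Wcount L c : ℂ) = (if IsNN L c.1 then 1 else 0) + (if IsNN L c.2 then 1 else 0)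
      + (if IsNN L (c.2 - c.1) then 1 else 0) := by
    intro c; unfold Wcount; push_cast; rfl
  have hsplit : cfgDFT L (fun c => (Wcount L c : ℂ) * trialK1 L f c) k₂ k₃
      = (∑ a : Tor L, (if IsNN L a then ∑ b : Tor L, (starRingEnd ℂ) (phase L k₂ a * phase L k₃ b) * trialK1 L f (a, b) else 0))
      + (∑ b : Tor L, (if IsNN L b then ∑ a : Tor L, (starRingEnd ℂ) (phase L k₂ a * phase L k₃ b) * trialK1 L f (a, b) else 0))
      + (∑ d : Tor L, (if IsNN L d then ∑ a : Tor L, (starRingEnd ℂ) (phase L k₂ a * phase L k₃ (a + d)) * trialK1 L f (a, a + d) else 0)) := by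
    unfold cfgDFT
    simp_rw [hW]
    have e3 : ∀ c : Cfg L, (starRingEnd ℂ) (phase L k₂ c.1 * phase L k₃ c.2) *
        (((if IsNN L c.1 then 1 else 0) + (if IsNN L c.2 then 1 else 0) + (if IsNN L (c.2 - c.1) then 1 else 0)) * trialK1 L f c)
        = (if IsNN L c.1 then (starRingEnd ℂ) (phase L k₂ c.1 * phase L k₃ c.2) * trialK1 L f c else 0)
        + (if IsNN L c.2 then (starRingEnd ℂ) (phase L k₂ c.1 * phase L k₃ c.2) * trialK1 L f c else 0)
        + (if IsNN L (c.2 - c.1) then (starRingEnd ℂ) (phase L k₂ c.1 * phase L k₃ c.2) * trialK1 L f c else 0) := by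
      intro c; split_ifs <;> ring
    simp_rw [e3]
    rw [Finset.sum_add_distrib, Finset.sum_add_distrib]
    have hre : ∀ a : Tor L, (∑ b : Tor L, (if IsNN L ((a, b).2 - (a, b).1) then
        (starRingEnd ℂ) (phase L k₂ (a, b).1 * phase L k₃ (a, b).2) * trialK1 L f (a, b) else 0))
        = ∑ d : Tor L, (if IsNN L d then (starRingEnd ℂ) (phase L k₂ a * phase L k₃ (a + d)) * trialK1 L f (a, a + d) else 0) := by
      intro a
      refine Fintype.sum_equiv (Equiv.subRight a) _ _ (fun b => ?_)
      simp only [Equiv.subRight_apply, add_sub_cancel]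
    congr 1
    congr 1
    · rw [Fintype.sum_prod_type]
      refine Finset.sum_congr rfl (fun a _ => ?_)
      split_ifs <;> simp
    · rw [Fintype.sum_prod_type_right]
      refine Finset.sum_congr rfl (fun b _ => ?_)
      split_ifs <;> simp
    · rw [Fintype.sum_prod_type, Finset.sum_congr rfl (fun a _ => hre a), Finset.sum_comm]
      refine Finset.sum_congr rfl (fun d _ => ?_)
      split_ifs <;> simp
  rw [hsplit, sum_ite_isNN_complex L hL, sum_ite_isNN_complex L hL, sum_ite_isNN_complex L hL,
    slice1 L f (ex L) f1, slice1 L f (-ex L) f2, slice1 L f (ey L) f3, slice1 L f (-ey L) f4,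
    slice2 L f hev (ex L) f1, slice2 L f hev (-ex L) f2, slice2 L f hev (ey L) f3, slice2 L f hev (-ey L) f4,
    slice3 L f (ex L) f1, slice3 L f (-ex L) f2, slice3 L f (ey L) f3, slice3 L f (-ey L) f4]
  unfold FTWfun
  rw [nnList_map_sum_complex]
  ring

/-- line `a = 0` of `H₀Ψ¹`: `Σ_b e^{−ik₃b}(H₀Ψ¹)(0,b) = −f_nn Σ_e[(1 + e^{iθe})Y_e(k₃) + Y_e(k₃ − K₁)]`. [folklore] -/
theorem lineA_H0 (_hL : 3 ≤ L) {Δ lam2 : ℝ} {f : Tor L → ℝ} (hf : IsTwoMagnon L Δ lam2 f) (k₃ : Tor L) :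
    (∑ b : Tor L, (starRingEnd ℂ) (phase L k₃ b) * H0apply L (K1 L) (trialK1 L f) (0, b))
      = -(f (K1 L) : ℂ) * ((nnList L).map (fun e => (1 + phase L (K1 L) e) * Yfun L f e k₃ + Yfun L f e (k₃ - K1 L))).sum := by
  have hnn := hf.2.1
  have hf0 : f 0 = 0 := hf.1
  have f1 : f (ex L) = f (K1 L) := hnn _ (by unfold nnList ex; simp)
  have f2 : f (-ex L) = f (K1 L) := hnn _ (by rw [← neg_ex]; unfold nnList; simp)
  have f3 : f (ey L) = f (K1 L) := hnn _ (by unfold nnList ey; simp)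
  have f4 : f (-ey L) = f (K1 L) := hnn _ (by rw [← neg_ey]; unfold nnList; simp)
  have hey := phase_K1_ey L
  have hmul := phase_mul_neg L (K1 L) (ex L)
  rw [nnList_map_sum_complex]
  unfold Yfun dft
  simp only [conj_phase_sub_K1]
  simp only [Finset.mul_sum, ← Finset.sum_add_distrib]
  refine Finset.sum_congr rfl (fun b _ => ?_)
  rw [H0apply_four]
  simp only [hopT, trialK1_apply, zero_add, zero_sub, add_zero, sub_zero, hf0, zero_mul, mul_zero,
    Complex.ofReal_zero, phase_zero]
  simp only [sub_eq_add_neg, neg_neg, neg_add_cancel_right, add_neg_cancel_right, phase_add, f1, f2, f3, f4, hey.1, hey.2,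
    mul_one]
  push_cast
  linear_combination (-(1 / 2 : ℂ) * (starRingEnd ℂ) (phase L k₃ b) * (f (K1 L) : ℂ) * (1 + phase L (K1 L) b)
    * ((f b : ℂ) * (f (b + -ex L) : ℂ) + (f b : ℂ) * (f (b + ex L) : ℂ))) * hmul

/-- line `b = 0` of `H₀Ψ¹`: `Σ_a e^{−ik₂a}(H₀Ψ¹)(a,0) = −f_nn Σ_e[(1 + e^{iθe})Y_e(k₂) + Y_e(k₂ − K₁)]` (`f` even). [folklore] -/
theorem lineB_H0 (_hL : 3 ≤ L) {Δ lam2 : ℝ} {f : Tor L → ℝ} (hf : IsTwoMagnon L Δ lam2 f) (hev : ∀ r : Tor L, f (-r) = f r)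
    (k₂ : Tor L) :
    (∑ a : Tor L, (starRingEnd ℂ) (phase L k₂ a) * H0apply L (K1 L) (trialK1 L f) (a, 0))
      = -(f (K1 L) : ℂ) * ((nnList L).map (fun e => (1 + phase L (K1 L) e) * Yfun L f e k₂ + Yfun L f e (k₂ - K1 L))).sum := by
  have hnn := hf.2.1
  have hf0 : f 0 = 0 := hf.1
  have f1 : f (ex L) = f (K1 L) := hnn _ (by unfold nnList ex; simp)
  have f2 : f (-ex L) = f (K1 L) := hnn _ (by rw [← neg_ex]; unfold nnList; simp)
  have f3 : f (ey L) = f (K1 L) := hnn _ (by unfold nnList ey; simp)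
  have f4 : f (-ey L) = f (K1 L) := hnn _ (by rw [← neg_ey]; unfold nnList; simp)
  have hey := phase_K1_ey L
  have hmul := phase_mul_neg L (K1 L) (ex L)
  rw [nnList_map_sum_complex]
  unfold Yfun dft
  simp only [conj_phase_sub_K1]
  simp only [Finset.mul_sum, ← Finset.sum_add_distrib]
  refine Finset.sum_congr rfl (fun a _ => ?_)
  have hsym : ∀ e : Tor L, f (e - a) = f (a - e) := fun e => by rw [← neg_sub, hev]
  rw [H0apply_four]
  simp only [hopT, trialK1_apply, zero_add, zero_sub, hf0, zero_mul, mul_zero,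
    Complex.ofReal_zero, phase_zero, hsym]
  simp only [sub_eq_add_neg, neg_neg, neg_add_rev, neg_add_cancel_left, add_neg_cancel_left, phase_add,
    f1, f2, f3, f4, hev, hey.1, hey.2, mul_one]
  push_cast
  linear_combination (-(1 / 2 : ℂ) * (starRingEnd ℂ) (phase L k₂ a) * (f (K1 L) : ℂ) * (1 + phase L (K1 L) a)
    * ((f a : ℂ) * (f (a + -ex L) : ℂ) + (f a : ℂ) * (f (a + ex L) : ℂ))) * hmul

/-- diagonal `a = b` of `H₀Ψ¹`: `Σ_a e^{−i(k₂+k₃)a}(H₀Ψ¹)(a,a) = −f_nn Σ_e[Y_{−e}(k₂+k₃) + (1 + e^{iθe})Y_{−e}(k₂+k₃−K₁)]`. [folklore] -/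
theorem lineD_H0 (_hL : 3 ≤ L) {Δ lam2 : ℝ} {f : Tor L → ℝ} (hf : IsTwoMagnon L Δ lam2 f) (k₂ k₃ : Tor L) :
    (∑ a : Tor L, (starRingEnd ℂ) (phase L k₂ a * phase L k₃ a) * H0apply L (K1 L) (trialK1 L f) (a, a))
      = -(f (K1 L) : ℂ) * ((nnList L).map (fun e =>
          Yfun L f (-e) (k₂ + k₃) + (1 + phase L (K1 L) e) * Yfun L f (-e) (k₂ + k₃ - K1 L))).sum := by
  have hnn := hf.2.1
  have hf0 : f 0 = 0 := hf.1
  have f1 : f (ex L) = f (K1 L) := hnn _ (by unfold nnList ex; simp)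
  have f2 : f (-ex L) = f (K1 L) := hnn _ (by rw [← neg_ex]; unfold nnList; simp)
  have f3 : f (ey L) = f (K1 L) := hnn _ (by unfold nnList ey; simp)
  have f4 : f (-ey L) = f (K1 L) := hnn _ (by rw [← neg_ey]; unfold nnList; simp)
  have hey := phase_K1_ey L
  rw [nnList_map_sum_complex]
  unfold Yfun dft
  simp only [conj_phase_sub_K1, phase_add_left, map_mul]
  simp only [Finset.mul_sum, ← Finset.sum_add_distrib]
  refine Finset.sum_congr rfl (fun a _ => ?_)
  rw [H0apply_four]
  simp only [hopT, trialK1_apply, sub_self, add_sub_cancel_left, sub_add_cancel_left, hf0, mul_zero,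
    Complex.ofReal_zero, add_zero]
  simp only [sub_eq_add_neg, neg_neg, phase_add, f1, f2, f3, f4, hey.1, hey.2, mul_one]
  push_cast
  ring

end RowD

/-- ★ **`RhatOneLoop L Δ` holds** (THE ONE-LOOP FORM of the residual coefficients). [folklore] -/
theorem rhatOneLoop_holds (Δ : ℝ) : RhatOneLoop L Δ := by
  intro lam2 f hL hf hev k₂ k₃
  have hf0 : f 0 = 0 := hf.1
  have hres : resid L Δ f = fun c => if InD L c then 0 else
      (H0apply L (K1 L) (trialK1 L f) c - (Δ : ℂ) * ((Wcount L c : ℂ) * trialK1 L f c)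
        - (((eps1 L + Tplus L Δ f : ℝ)) : ℂ) * trialK1 L f c) := by
    funext c
    unfold resid residual Happly
    split_ifs
    · rfl
    · ring
  have hPsi : cfgDFT L (trialK1 L f) k₂ k₃ = PsiHat1 L f k₂ k₃ := by
    unfold trialK1 PsiHat1 PiHat
    exact RowD.cfgDFT_vfun_mul L (prodState L f) k₂ k₃
  have hΨA : ∀ b : Tor L, trialK1 L f (0, b) = 0 := fun b => by
    rw [RowD.trialK1_apply, hf0]; simp
  have hΨB : ∀ a : Tor L, trialK1 L f (a, 0) = 0 := fun a => by
    rw [RowD.trialK1_apply, hf0]; simp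
  have hΨD : ∀ a : Tor L, trialK1 L f (a, a) = 0 := fun a => by
    rw [RowD.trialK1_apply, sub_self, hf0]; simp
  have h00 : H0apply L (K1 L) (trialK1 L f) (0, 0) = 0 := by
    rw [H0apply_four]
    simp [hopT, hΨA, hΨB, hΨD]
  rw [hres, offDTransform_holds]
  rw [RowD.cfgDFT_sub'', RowD.cfgDFT_sub'', RowD.cfgDFT_smul', RowD.cfgDFT_smul', RowD.cfgDFT_H0apply,
    RowD.ftW_eq L hL hf hev, hPsi]
  have hA : (∑ b : Tor L, (starRingEnd ℂ) (phase L k₃ b) *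
      (H0apply L (K1 L) (trialK1 L f) (0, b) - (Δ : ℂ) * ((Wcount L (0, b) : ℂ) * trialK1 L f (0, b))
        - (((eps1 L + Tplus L Δ f : ℝ)) : ℂ) * trialK1 L f (0, b)))
      = ∑ b : Tor L, (starRingEnd ℂ) (phase L k₃ b) * H0apply L (K1 L) (trialK1 L f) (0, b) :=
    Finset.sum_congr rfl (fun b _ => by rw [hΨA]; ring)
  have hB : (∑ a : Tor L, (starRingEnd ℂ) (phase L k₂ a) *
      (H0apply L (K1 L) (trialK1 L f) (a, 0) - (Δ : ℂ) * ((Wcount L (a, 0) : ℂ) * trialK1 L f (a, 0))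
        - (((eps1 L + Tplus L Δ f : ℝ)) : ℂ) * trialK1 L f (a, 0)))
      = ∑ a : Tor L, (starRingEnd ℂ) (phase L k₂ a) * H0apply L (K1 L) (trialK1 L f) (a, 0) :=
    Finset.sum_congr rfl (fun a _ => by rw [hΨB]; ring)
  have hD : (∑ a : Tor L, (starRingEnd ℂ) (phase L k₂ a * phase L k₃ a) *
      (H0apply L (K1 L) (trialK1 L f) (a, a) - (Δ : ℂ) * ((Wcount L (a, a) : ℂ) * trialK1 L f (a, a))
        - (((eps1 L + Tplus L Δ f : ℝ)) : ℂ) * trialK1 L f (a, a)))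
      = ∑ a : Tor L, (starRingEnd ℂ) (phase L k₂ a * phase L k₃ a) * H0apply L (K1 L) (trialK1 L f) (a, a) :=
    Finset.sum_congr rfl (fun a _ => by rw [hΨD]; ring)
  rw [hA, hB, hD, h00, hΨA, RowD.lineA_H0 L hL hf k₃, RowD.lineB_H0 L hL hf hev k₂, RowD.lineD_H0 L hL hf k₂ k₃]
  have hden : den L (Tplus L Δ f) k₂ k₃ = efree L (k₂, k₃) - eps1 L - Tplus L Δ f := den_eq L _ (k₂, k₃)
  rw [hden]
  unfold Bdfun
  rw [RowD.nnList_map_sum_complex, RowD.nnList_map_sum_complex, RowD.nnList_map_sum_complex, RowD.nnList_map_sum_complex]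
  push_cast
  ring

/-- ★ **`LowGRowForm L Δ` holds** (THE ROW FORM of `lowG`, via …RowDLowGRow). [folklore] -/
theorem lowGRowForm_holds' (Δ : ℝ) : LowGRowForm L Δ :=
  RowD.lowGRowForm_of_rhatOneLoop L Δ (rhatOneLoop_holds L Δ)



end Summit.HubbardSuperconductivity.HubbardSuperconductivity.Theorems.AnisotropyChord.Transfer.Fibre3

end
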